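import Mathlib
import HarnessLib
import Summits.AtomisticToContinuum.FouriersLaw.Theses.JunctionLocality
import Summits.AtomisticToContinuum.FouriersLaw.Theorems.JunctionLocalityConductanceLowerBoundCertificatePrinciple

/-!
# The certificate form of the crux is loss-free: `ConductanceLowerBound ⟺ certificates`
(crux stmt-AtomisticToContinuum-11749, line `ForecastSensitivitySketch`)

Helper file (`--supports stmt-AtomisticToContinuum-11749`, lead c5).  Setting as in `…CertificatePrinciple`: admissible pairs `(φ, χ)` of
the `L`-chain `pinnedChain ω₂ lam β γ` at temperature `T` (`γ S_B φ + X_H χ = −(p_0² − T)` pointwise, contact gradients in `L²(μ_T)`),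
contact cost `cost(φ,χ) = Σ_{b∈{0,L−1}} (‖∂_{p_b}φ‖² + ‖∂_{p_b}χ‖²)`.

* `certificates_of_floor` — the converse of `floor_of_certificates`: if the transmission-gradient floor holds with constant `c`, then for
  every large `L` the SYMMETRISED FORWARD PAIR `((g + g∘Θ)/2, (g − g∘Θ)/2)` (`g` a left forward field, `Θ` momentum reversal) is
  admissible with cost `E_near + E_far = T/γ² − 2E_far ≤ T/γ² − 2c/(L−1)` (sum rule `nearGradient_sq_eq`, reversal invariance).
* `conductanceLowerBound_iff_certificates` — hence the crux is EQUIVALENT to the existence, for all parameters and all large `L`, of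
  admissible pairs of cost `≤ T/γ² − c/(L−1)`: a fourth loss-free costume of stmt-11749 (after the floor p96126, the odd-field ceiling
  p138303 and the variance/committor forms), this one an explicit inf-side variational problem with typed no-go lemmas
  (`…CertificateObstruction`).

No new definitions, no named facts, no sorry.  References: Bernardin–Olla 2011 §6; Komorowski–Landim–Olla 2012 §4.2; folklore.
-/

noncomputable section

open MeasureTheory Filter Topology
open scoped ContDiff
open Literature.MathematicalPhysics.KineticTheory.HeatConduction
open Summit.AtomisticToContinuum.FouriersLaw.Theorems.SuperadditiveResistance.DeviceLiouville
  (kin kin_eq_sq continuous_kin liouvilleOp bathOp generator_eq_liouvilleOp_add lineP differentiable_lineP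
    partialP_eq_deriv_lineP)
open Summit.AtomisticToContinuum.FouriersLaw.Theorems.SuperadditiveResistance.Kubo
  (memLp_partialP integrable_sq_mul_gibbsDensity memLp_kinetic
    rev rev_apply contDiff_rev memLp_rev rev_pair partialP_rev integral_rev_mul_gibbsDensity)
open Summit.AtomisticToContinuum.FouriersLaw.Cruxes.SuperadditiveResistance.FloatingProbeBypassLaplacian
  (stub_plainForwardField liouvilleOp_add' liouvilleOp_const_mul bathOp_add' bathOp_const_mul)
open Summit.AtomisticToContinuum.FouriersLaw.Theses.JunctionLocality (ConductanceLowerBound)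

namespace Summit.AtomisticToContinuum.FouriersLaw.Cruxes.ConductanceLowerBound.ForecastSensitivity

variable {ω₂ lam β γ T : ℝ}

/-! ## Calculus of the symmetrised pair -/

section Halves

variable {L : ℕ}

/-- `∂_{p_i} (½(g + h)) = ½(∂_{p_i} g + ∂_{p_i} h)`. [folklore] -/
theorem partialP_half_add {g h : PhaseSpace L → ℝ} (hg : Differentiable ℝ g) (hh : Differentiable ℝ h)
    (i : Fin L) (x : PhaseSpace L) :
    partialP i (fun y => (1 / 2 : ℝ) * (g + h) y) x = (1 / 2) * (partialP i g x + partialP i h x) := by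
  have hd := (((differentiable_lineP hg i x (x.2 i)).hasDerivAt.add
    (differentiable_lineP hh i x (x.2 i)).hasDerivAt).const_mul (1 / 2 : ℝ)).deriv
  rw [partialP_eq_deriv_lineP, partialP_eq_deriv_lineP, partialP_eq_deriv_lineP, ← hd]
  rfl

/-- `∂_{p_i} (½(g − h)) = ½(∂_{p_i} g − ∂_{p_i} h)`. [folklore] -/
theorem partialP_half_sub {g h : PhaseSpace L → ℝ} (hg : Differentiable ℝ g) (hh : Differentiable ℝ h)
    (i : Fin L) (x : PhaseSpace L) :
    partialP i (fun y => (1 / 2 : ℝ) * (g - h) y) x = (1 / 2) * (partialP i g x - partialP i h x) := by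
  have hd := (((differentiable_lineP hg i x (x.2 i)).hasDerivAt.sub
    (differentiable_lineP hh i x (x.2 i)).hasDerivAt).const_mul (1 / 2 : ℝ)).deriv
  rw [partialP_eq_deriv_lineP, partialP_eq_deriv_lineP, partialP_eq_deriv_lineP, ← hd]
  rfl

/-- `X_H (½(g − h)) = ½(X_H g − X_H h)`. [folklore] -/
theorem liouvilleOp_half_sub (P : OscillatorChain) {g h : PhaseSpace L → ℝ} (hg : Differentiable ℝ g)
    (hh : Differentiable ℝ h) (x : PhaseSpace L) :
    liouvilleOp P L (fun y => (1 / 2 : ℝ) * (g - h) y) x = (1 / 2) * (liouvilleOp P L g x - liouvilleOp P L h x) := by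
  rw [liouvilleOp_const_mul]
  congr 1
  have e : (g - h) = (g + fun y => (-1 : ℝ) * h y) := by funext y; simp; ring
  rw [e, liouvilleOp_add' P hg (hh.const_mul (-1)), liouvilleOp_const_mul]
  ring

/-- `S_B (½(g + h)) = ½(S_B g + S_B h)` for `g, h ∈ C²`. [folklore] -/
theorem bathOp_half_add {g h : PhaseSpace L → ℝ} (hg : ContDiff ℝ 2 g) (hh : ContDiff ℝ 2 h)
    (B : Fin L → ℝ) (T : ℝ) (x : PhaseSpace L) :
    bathOp L B T (fun y => (1 / 2 : ℝ) * (g + h) y) x = (1 / 2) * (bathOp L B T g x + bathOp L B T h x) := by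
  rw [bathOp_const_mul, bathOp_add' hg hh]

end Halves

/-! ## The symmetrised forward pair is an admissible certificate of cost `T/γ² − 2E_far` -/

/-- **Certificates from the floor.**  If the transmission-gradient floor holds (constant `c`, threshold `L₁`), then for all
parameters `> 0`, `T > 0` and `L ≥ max L₁ 2`, the symmetrised forward pair `((g + g∘Θ)/2, (g − g∘Θ)/2)` of a left forward field
`g` (exists: `stub_plainForwardField`) is an admissible pair of cost `T/γ² − 2‖∂_{p_{L−1}}g‖² ≤ T/γ² − 2c/(L−1)`. [folklore] -/
theorem certificates_of_floor
    (hF : ∀ (ω₂ lam β γ T : ℝ), 0 < ω₂ → 0 < lam → 0 < β → 0 < γ → 0 < T →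
      ∃ c : ℝ, 0 < c ∧ ∃ L₁ : ℕ, ∀ (L : ℕ) (hL : 2 ≤ L), L₁ ≤ L → ∀ g : PhaseSpace L → ℝ, ContDiff ℝ 2 g →
        MemLp g 2 ((pinnedChain ω₂ lam β γ).gibbsMeasure L T) →
        ∫ x, g x ∂((pinnedChain ω₂ lam β γ).gibbsMeasure L T) = 0 →
        (∀ x, (pinnedChain ω₂ lam β γ).generator L T T g x = -(kin L 0 x - T)) →
        c ≤ ((L : ℝ) - 1) *
          ∫ x, (partialP (⟨L - 1, by omega⟩ : Fin L) g x) ^ 2 ∂((pinnedChain ω₂ lam β γ).gibbsMeasure L T)) :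
    ∀ (ω₂ lam β γ T : ℝ), 0 < ω₂ → 0 < lam → 0 < β → 0 < γ → 0 < T →
      ∃ c : ℝ, 0 < c ∧ ∃ L₁ : ℕ, ∀ (L : ℕ) (hL : 2 ≤ L), L₁ ≤ L → ∃ φ χ : PhaseSpace L → ℝ,
        ContDiff ℝ 2 φ ∧ ContDiff ℝ 2 χ ∧
        MemLp (partialP (⟨0, by omega⟩ : Fin L) φ) 2 ((pinnedChain ω₂ lam β γ).gibbsMeasure L T) ∧
        MemLp (partialP (⟨L - 1, by omega⟩ : Fin L) φ) 2 ((pinnedChain ω₂ lam β γ).gibbsMeasure L T) ∧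
        MemLp (partialP (⟨0, by omega⟩ : Fin L) χ) 2 ((pinnedChain ω₂ lam β γ).gibbsMeasure L T) ∧
        MemLp (partialP (⟨L - 1, by omega⟩ : Fin L) χ) 2 ((pinnedChain ω₂ lam β γ).gibbsMeasure L T) ∧
        MemLp χ 2 ((pinnedChain ω₂ lam β γ).gibbsMeasure L T) ∧
        (∀ x, γ * bathOp L (OscillatorChain.bathWeight L) T φ x +
          liouvilleOp (pinnedChain ω₂ lam β γ) L χ x = -(kin L 0 x - T)) ∧
        ((∫ x, (partialP (⟨0, by omega⟩ : Fin L) φ x) ^ 2 ∂((pinnedChain ω₂ lam β γ).gibbsMeasure L T)) +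
            ∫ x, (partialP (⟨L - 1, by omega⟩ : Fin L) φ x) ^ 2 ∂((pinnedChain ω₂ lam β γ).gibbsMeasure L T)) +
          ((∫ x, (partialP (⟨0, by omega⟩ : Fin L) χ x) ^ 2 ∂((pinnedChain ω₂ lam β γ).gibbsMeasure L T)) +
            ∫ x, (partialP (⟨L - 1, by omega⟩ : Fin L) χ x) ^ 2 ∂((pinnedChain ω₂ lam β γ).gibbsMeasure L T)) ≤
          T / γ ^ 2 - c / ((L : ℝ) - 1) := by
  intro ω₂ lam β γ T hω hl hβ hγ hT
  obtain ⟨c, hc, L₁, hfloor⟩ := hF ω₂ lam β γ T hω hl hβ hγ hT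
  refine ⟨2 * c, by positivity, L₁, fun L hL hL₁ => ?_⟩
  have hL0 : 0 < L := by omega
  have hL1 : L - 1 < L := by omega
  set B := OscillatorChain.bathWeight L with hB
  set i0 : Fin L := ⟨0, hL0⟩ with hi0
  set iR : Fin L := ⟨L - 1, hL1⟩ with hiR
  set μ := (pinnedChain ω₂ lam β γ).gibbsMeasure L T with hμ
  haveI : IsProbabilityMeasure μ := pinnedChain_isProbabilityMeasure_gibbsMeasure hω hl.le hβ.le γ L hT
  have hBnn : ∀ i, 0 ≤ B i := bathWeight_nonneg L
  have hB0 : 0 < B i0 := bathWeight_pos_of_val (Or.inl rfl)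
  have hBR : 0 < B iR := bathWeight_pos_of_val (Or.inr rfl)
  -- a left forward field and its reversal
  obtain ⟨g, hgC, hgL2, hg0, hgeq⟩ := stub_plainForwardField ω₂ lam β γ T hω hl hβ hγ hT L hL
  have hgd : Differentiable ℝ g := hgC.differentiable two_ne_zero
  have hgc : Continuous g := hgC.continuous
  have hk2 : MemLp (fun x : PhaseSpace L => kin L 0 x - T) 2 μ :=
    (memLp_kinetic hω hl.le hβ.le L hT i0).ae_eq (ae_of_all _ fun x => by simp only [kin_eq_sq hL0]; rfl)
  have hpde1 : ∀ x, 1 * liouvilleOp (pinnedChain ω₂ lam β γ) L g x + γ * bathOp L B T g x = -(kin L 0 x - T) :=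
    fun x => by rw [one_mul, ← hgeq x, generator_eq_liouvilleOp_add]; rfl
  set gt : PhaseSpace L → ℝ := rev g with hgt
  have hgtC : ContDiff ℝ 2 gt := contDiff_rev hgC
  have hgtd : Differentiable ℝ gt := hgtC.differentiable two_ne_zero
  have hgtL2 : MemLp gt 2 μ := memLp_rev hω hl.le hβ.le L hT hgc hgL2
  have hpde2 : ∀ x, (-1) * liouvilleOp (pinnedChain ω₂ lam β γ) L gt x + γ * bathOp L B T gt x = -(kin L 0 x - T) := by
    intro x
    have h := rev_pair (pinnedChain ω₂ lam β γ) B T 1 γ (k := fun y => kin L 0 y - T) hpde1 x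
    rw [rev_apply, kin_sub_neg_momentum hL0] at h
    simpa only [hgt, neg_mul, one_mul] using h
  have hdg : ∀ {i : Fin L}, 0 < B i → MemLp (partialP i g) 2 μ := fun {i} hi =>
    memLp_partialP hω hl.le hβ.le γ L hT B hBnn 1 hγ hgC hgL2 hk2 hpde1 hi
  have hdgt : ∀ {i : Fin L}, 0 < B i → MemLp (partialP i gt) 2 μ := fun {i} hi =>
    memLp_partialP hω hl.le hβ.le γ L hT B hBnn (-1) hγ hgtC hgtL2 hk2 hpde2 hi
  -- the symmetrised pair
  set φ : PhaseSpace L → ℝ := fun y => (1 / 2 : ℝ) * (g + gt) y with hφ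
  set χ : PhaseSpace L → ℝ := fun y => (1 / 2 : ℝ) * (g - gt) y with hχ
  have hφC : ContDiff ℝ 2 φ := contDiff_const.mul (hgC.add hgtC)
  have hχC : ContDiff ℝ 2 χ := contDiff_const.mul (hgC.sub hgtC)
  have hdφ : ∀ i, partialP i φ = fun x => (1 / 2) * (partialP i g x + partialP i gt x) :=
    fun i => funext fun x => partialP_half_add hgd hgtd i x
  have hdχ : ∀ i, partialP i χ = fun x => (1 / 2) * (partialP i g x - partialP i gt x) :=
    fun i => funext fun x => partialP_half_sub hgd hgtd i x
  have hdφ2 : ∀ {i : Fin L}, 0 < B i → MemLp (partialP i φ) 2 μ := fun {i} hi => by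
    rw [hdφ i]; exact ((hdg hi).add (hdgt hi)).const_mul _
  have hdχ2 : ∀ {i : Fin L}, 0 < B i → MemLp (partialP i χ) 2 μ := fun {i} hi => by
    rw [hdχ i]; exact ((hdg hi).sub (hdgt hi)).const_mul _
  have hχ2 : MemLp χ 2 μ := (hgL2.sub hgtL2).const_mul _
  -- admissibility: γ S_B φ + X_H χ = ½[(γS_B g + X_H g) + (γ S_B g∘Θ − X_H g∘Θ)] = −(p_0² − T)
  have hpair : ∀ x, γ * bathOp L B T φ x + liouvilleOp (pinnedChain ω₂ lam β γ) L χ x = -(kin L 0 x - T) := by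
    intro x
    rw [show bathOp L B T φ x = (1 / 2) * (bathOp L B T g x + bathOp L B T gt x) from bathOp_half_add hgC hgtC B T x,
      show liouvilleOp (pinnedChain ω₂ lam β γ) L χ x =
        (1 / 2) * (liouvilleOp (pinnedChain ω₂ lam β γ) L g x - liouvilleOp (pinnedChain ω₂ lam β γ) L gt x) from
        liouvilleOp_half_sub _ hgd hgtd x]
    have h1 := hpde1 x
    have h2 := hpde2 x
    linarith
  -- the cost: ‖∂_bφ‖² + ‖∂_bχ‖² = ½(‖∂_bg‖² + ‖∂_b g∘Θ‖²) = ‖∂_b g‖²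
  have Rb : ∀ i : Fin L, ∫ x, partialP i gt x ^ 2 ∂μ = ∫ x, partialP i g x ^ 2 ∂μ := by
    intro i
    rw [hμ, OscillatorChain.integral_gibbsMeasure, OscillatorChain.integral_gibbsMeasure,
      ← integral_rev_mul_gibbsDensity (pinnedChain ω₂ lam β γ) T (fun y => partialP i g y ^ 2)]
    congr 1
    refine integral_congr_ae (ae_of_all _ fun x => ?_)
    show partialP i gt x ^ 2 * _ = rev (fun y => partialP i g y ^ 2) x * _
    rw [hgt, partialP_rev, rev_apply, neg_sq]
  have hcost : ∀ {i : Fin L}, 0 < B i →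
      (∫ x, (partialP i φ x) ^ 2 ∂μ) + ∫ x, (partialP i χ x) ^ 2 ∂μ = ∫ x, (partialP i g x) ^ 2 ∂μ := by
    intro i hi
    have hI1 : Integrable (fun x => partialP i g x ^ 2) μ := (hdg hi).integrable_sq
    have hI2 : Integrable (fun x => partialP i gt x ^ 2) μ := (hdgt hi).integrable_sq
    have e : (∫ x, (partialP i φ x) ^ 2 ∂μ) + ∫ x, (partialP i χ x) ^ 2 ∂μ =
        ∫ x, ((1 / 2) * partialP i g x ^ 2 + (1 / 2) * partialP i gt x ^ 2) ∂μ := by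
      rw [← integral_add ((hdφ2 hi).integrable_sq) ((hdχ2 hi).integrable_sq)]
      refine integral_congr_ae (ae_of_all _ fun x => ?_)
      simp only [hdφ i, hdχ i]
      ring
    rw [e, integral_add (hI1.const_mul _) (hI2.const_mul _), integral_const_mul, integral_const_mul, Rb i]
    ring
  have hsum := nearGradient_sq_eq hω hl hβ hγ hT hL hgC hgL2 hg0 hgeq
  have hfl := hfloor L hL hL₁ g hgC hgL2 hg0 hgeq
  have hLpos : (0 : ℝ) < (L : ℝ) - 1 := by
    have : (2 : ℝ) ≤ L := by exact_mod_cast hL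
    linarith
  have hEfar : c / ((L : ℝ) - 1) ≤ ∫ x, (partialP iR g x) ^ 2 ∂μ := by
    rw [div_le_iff₀ hLpos]; linarith
  refine ⟨φ, χ, hφC, hχC, hdφ2 hB0, hdφ2 hBR, hdχ2 hB0, hdχ2 hBR, hχ2, hpair, ?_⟩
  have c0 := hcost hB0
  have cR := hcost hBR
  have e2 : 2 * c / ((L : ℝ) - 1) = 2 * (c / ((L : ℝ) - 1)) := by ring
  rw [e2]
  linarith [c0, cR, hsum, hEfar]

/-- **`ConductanceLowerBound` ⟺ certificates.**  The crux holds iff for all parameters `> 0`, `T > 0` there are `c > 0`, `L₁`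
such that every `L`-chain with `L ≥ L₁` (`L ≥ 2`) carries an admissible pair `(φ, χ)` of contact cost `≤ T/γ² − c/(L−1)`
(`⟸`: `conductanceLowerBound_of_certificates`; `⟹`: `floor_of_conductanceLowerBound` then `certificates_of_floor`). [folklore] -/
theorem conductanceLowerBound_iff_certificates : Summit.AtomisticToContinuum.FouriersLaw.Theses.JunctionLocality.ConductanceLowerBound ↔ ∀ (ω₂ lam β γ T : ℝ), 0 < ω₂ → 0 < lam → 0 < β → 0 < γ → 0 < T → ∃ c : ℝ, 0 < c ∧ ∃ L₁ : ℕ, ∀ (L : ℕ) (hL : 2 ≤ L), L₁ ≤ L → ∃ φ χ : PhaseSpace L → ℝ, ContDiff ℝ 2 φ ∧ ContDiff ℝ 2 χ ∧ MemLp (partialP (⟨0, by omega⟩ : Fin L) φ) 2 ((pinnedChain ω₂ lam β γ).gibbsMeasure L T) ∧ MemLp (partialP (⟨L - 1, by omega⟩ : Fin L) φ) 2 ((pinnedChain ω₂ lam β γ).gibbsMeasure L T) ∧ MemLp (partialP (⟨0, by omega⟩ : Fin L) χ) 2 ((pinnedChain ω₂ lam β γ).gibbsMeasure L T) ∧ MemLp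 (partialP (⟨L - 1, by omega⟩ : Fin L) χ) 2 ((pinnedChain ω₂ lam β γ).gibbsMeasure L T) ∧ MemLp χ 2 ((pinnedChain ω₂ lam β γ).gibbsMeasure L T) ∧ (∀ x, γ * bathOp L (OscillatorChain.bathWeight L) T φ x + liouvilleOp (pinnedChain ω₂ lam β γ) L χ x = -(kin L 0 x - T)) ∧ ((∫ x, (partialP (⟨0, by omega⟩ : Fin L) φ x) ^ 2 ∂((pinnedChain ω₂ lam β γ).gibbsMeasure L T)) + ∫ x, (partialP (⟨L - 1, by omega⟩ : Fin L) φ x) ^ 2 ∂((pinnedChain ω₂ lam β γ).gibbsMeasure L T)) + ((∫ x, (partialP (⟨0, by omega⟩ : Fin L) χ x) ^ 2 ∂((pinnedChain ω₂ lam β γ).gibbsMeasure L T)) + ∫ x, (partialP (⟨L - 1, by omega⟩ : Fin L) χ x) ^ 2 ∂((pinnedChain ω₂ lam β γ).gibbsMeasure L T)) ≤ T / γ ^ 2 - c / ((L : ℝ) - 1) :=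
  ⟨fun h => certificates_of_floor (floor_of_conductanceLowerBound h), conductanceLowerBound_of_certificates⟩

end Summit.AtomisticToContinuum.FouriersLaw.Cruxes.ConductanceLowerBound.ForecastSensitivity

end
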